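import Mathlib
import Literature.NumberTheory.LFunctions.Zhang2022.Section12Eq126Reduction
import Literature.NumberTheory.LFunctions.Zhang2022.Section12Eq126ProfileSharp
import Literature.NumberTheory.LFunctions.Zhang2022.Section11SjTrueSizeBound
import Literature.NumberTheory.LFunctions.Zhang2022.Section11WindowSj
import Literature.NumberTheory.LFunctions.Zhang2022.Section7SjBilinear
import HarnessLib

/-!
# Zhang (2022) §12 (12.6) p. 67: the window estimate `S_j(𝐛,𝐛̄) = o(α𝔞)` REDUCED TO ITS INNER CORE

Topic `Literature/NumberTheory/LFunctions/Zhang2022` (Landau–Siegel audit tree; verdict-neutral).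
Y. Zhang, *Discrete mean estimates and the Landau–Siegel zero*, arXiv:2211.02515v1 (2022)
[Zhang2022LandauSiegel] — **an unrefereed manuscript under adjudication; nothing in this file
asserts or denies its Theorems 1–2.** Helper under the skeleton binder `h126`
(`Typed.Sec12A.Eq126 c′`, the (12.6) half of the leaf hXi = `Typed.Sec12A.Xi15Hbar16`; cell GAP
row G-d42-2). What this is: kernel theorems about typed-as-printed displays of the manuscript and
the (8.25)/(8.26)-type window estimate they need (v1 writes «≪» at §12 p. 67, tex L3404–L3415, and
cites displays (8.25)/(8.26) that do not exist); the manuscript's own steps u004–u008 are not used.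
No statement about Landau–Siegel zeros is made or implied.

## The reduction

The tree theorem `Typed.Sec12A.eq126_of_sj_small` (p415223) derives (12.6) from Prop. 2.2 (i),
Lemma 2.3, Lemma 8.1, Prop. 7.1 (all theorems) and ONE estimate `hS`: for every `ε > 0`, eventually
under (A), `‖S_j(𝐛,𝐛̄)‖ ≤ ε·α·𝔞` (`j = 1,2,3`) for the literal coefficient sequence
`𝐛(n) = χ(n)(ϰ₁(n)𝟙[P^{1/2} ≤ n < ⌈P₁⌉] − ϰ₁₂(n)𝟙[P^{0.5}η₋ < n < P₁η₊])` (data abbreviation `b126`;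
`Sj_b126_eq` is `rfl`). By the SHARP profile of `𝐛` (tree `Section12Eq126ProfileSharp`, p478648:
`‖𝐛 n‖ ≤ 2𝓛⁻²⁴ + 0.004e^{−𝓛³⁰(log n − 𝓛⁹/2)²}`, `≤ 0.008e^{−𝓛³⁰w²}` at log-distance `≥ w` from
both `P^{1/2}` and `P₁ = P^{0.504}`, `≤ 0.005` globally) the sequence is `O(1)` only on the INNER
window `|log n − 𝓛⁹/2| < 𝓛⁻¹⁴`. Split (WP11-PLAN v2 §8.1)

  `𝐛 = 𝐛_in + 𝐛_near + 𝐛_far`, `IN := |log n − 𝓛⁹/2| < 𝓛⁻¹⁴`,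
  `NEAR := ¬IN ∧ (|log n − 𝓛⁹/2| < 𝓛⁻¹⁰ ∨ |log n − 0.504𝓛⁹| < 𝓛⁻¹⁰)`, `FAR :=` the rest

(data abbreviations `b126In`, `b126Near`, `b126Far`; `b126_decomp`), with sups
`‖𝐛_in‖ ≤ 0.005`, `‖𝐛_near‖ ≤ 2·10⁶𝓛⁻²⁴` (`2𝓛⁻²⁴ + 0.004e^{−𝓛²}`, `e^{−𝓛²} ≤ 12!/𝓛²⁴`),
`‖𝐛_far‖ ≤ 0.192𝓛⁻⁴⁰` (`0.008e^{−𝓛¹⁰}`, `e^{−𝓛¹⁰} ≤ 4!/𝓛⁴⁰`), and `𝐛_in`, `𝐛_near` supported in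
the two `η`-windows `(xη₋, xη₊)`, `x ∈ {P^{1/2}, P^{0.504}}`, `η± = e^{±𝓛⁻¹⁰}`. `S_j` is bilinear
(tree `Section7SjBilinear`), so `S_j(𝐛,𝐛̄) − S_j(𝐛_in,𝐛̄_in)` is a sum of eight pairs, each priced
by absolute values with a TREE engine:

* `(in,near)`, `(near,in)` by the window bound `WindowSj.norm_Sj_window_le` (p477114, two centres):
  `≤ C·4·0.005·2·10⁶𝓛⁻²⁴·𝓛⁸ = O(𝓛⁻¹⁶)`;
* every other pair by the true-size bound `XiZeroMajorant.norm_Sj_le_of_bounds` (p477106, any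
  bounded sequences, `≤ C_S·B₁B₂·𝓛²⁷`): `O(𝓛⁻¹³)` with a `𝐛_far`, `O(𝓛⁻²¹)` for the
  `(near+far, near+far)` block.

So `‖S_j(𝐛,𝐛̄) − S_j(𝐛_in,𝐛̄_in)‖ ≤ K·𝓛⁻¹³ ≤ (ε/2)·α·𝔞` for `𝓛 ≥ 𝓛₀(ε)` (`α = π𝓛⁻⁹`, `𝔞 ≥ a₀`
by `frakALowerBound_holds`), and `hS` follows from the CORE estimate for `S_j(𝐛_in,𝐛̄_in)` alone
(`Sj_h15_window_small_of_inner`; the core — relative width `2𝓛⁻¹⁴`, sup `0.005`, margin `𝓛⁵` — is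
the coupled-window engine's, `SjWindowEngine.window_triple_sum_le`, filed separately by its owner).

The eight-pair bookkeeping is stated ONCE generically (`norm_Sj_conj_sub_inner_le`: any
`𝐚 = 𝐚_in + 𝐚_near + 𝐚_far` with sups `B₀, B₁, B₂`, `𝐚_in`, `𝐚_near` in two `η`-windows with
centres `≤ P` ⇒ `‖S_j(𝐚,𝐚̄) − S_j(𝐚_in,𝐚̄_in)‖ ≤ K(B₀B₁𝓛⁸ + B₀B₂𝓛²⁷ + (B₁+B₂)²𝓛²⁷)`), so that the
(12.8) twin is a specialisation.

Definitions here are DATA ABBREVIATIONS of printed objects (`b126` = the literal `hS` sequence,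
its three restrictions); no `Prop` is defined, no claim of the manuscript is asserted. Standard axioms.

## References

* Y. Zhang, arXiv:2211.02515v1 (2022), §12 (12.6) p. 66–67 (tex L3386–L3415); §7 Prop. 7.1
  p. 33–34; §11 p. 64. [cite: Zhang2022LandauSiegel, §12 (12.6) p.67]
-/

noncomputable section

open Complex Real ComplexConjugate

namespace Literature.NumberTheory.LFunctions.Zhang2022.Typed.Sec12A

open Skeleton

/-! ### Elementary helpers -/

/-- From `⌈exp K⌉ ≤ D`: `K ≤ log D = 𝓛`. [folklore] -/
private theorem le_ell_of_ceil_exp_le_pieces {K : ℝ} {D : ℕ} (hD : ⌈Real.exp K⌉₊ ≤ D) :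
    K ≤ ell D := by
  have hexp : Real.exp K ≤ D := le_trans (Nat.le_ceil _) (by exact_mod_cast hD)
  rw [ell]
  exact (Real.le_log_iff_exp_le (lt_of_lt_of_le (Real.exp_pos _) hexp)).mpr hexp

/-- From `⌈exp K⌉ ≤ D` with `K ≥ 1`: `2 ≤ D`. [folklore] -/
private theorem two_le_of_ceil_exp_le {K : ℝ} {D : ℕ} (hK : 1 ≤ K) (hD : ⌈Real.exp K⌉₊ ≤ D) :
    2 ≤ D := by
  have hexp : Real.exp K ≤ D := le_trans (Nat.le_ceil _) (by exact_mod_cast hD)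
  have h2 : (2 : ℝ) ≤ Real.exp K := by
    have := Real.add_one_le_exp K; linarith
  exact_mod_cast (le_trans h2 hexp)

/-- `e^{−y} ≤ k!/y^k` for `y > 0` (from `y^k/k! ≤ e^y`). [folklore] -/
private theorem exp_neg_le_factorial_div {y : ℝ} (hy : 0 < y) (k : ℕ) :
    Real.exp (-y) ≤ (k.factorial : ℝ) / y ^ k := by
  have h := Real.pow_div_factorial_le_exp y hy.le k
  have hk : (0 : ℝ) < k.factorial := by exact_mod_cast Nat.factorial_pos k
  have hyk : 0 < y ^ k := pow_pos hy k
  rw [Real.exp_neg, inv_eq_one_div, div_le_div_iff₀ (Real.exp_pos y) hyk, one_mul]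
  rw [div_le_iff₀ hk] at h
  linarith

/-- A log-window is an `η`-window: if `n > 0` and `|log n − c| < δ ≤ 𝓛⁻¹⁰` then
`e^c·η₋ < n < e^c·η₊` (`η± = etaPM D (±1) = e^{±𝓛⁻¹⁰}`). [cite: Zhang2022LandauSiegel, §11 p.63] -/
private theorem window_of_abs_log_lt {D n : ℕ} (hn : 0 < (n : ℝ)) {c δ : ℝ}
    (hδ : δ ≤ (ell D ^ 10)⁻¹) (h : |Real.log n - c| < δ) :
    Real.exp c * etaPM D (-1) < n ∧ (n : ℝ) < Real.exp c * etaPM D 1 := by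
  rw [abs_lt] at h
  obtain ⟨h1, h2⟩ := h
  constructor
  · rw [etaPM, ← Real.exp_add]
    calc Real.exp (c + -1 * (ell D ^ 10)⁻¹) < Real.exp (Real.log n) :=
          Real.exp_lt_exp.mpr (by linarith)
      _ = n := Real.exp_log hn
  · rw [etaPM, ← Real.exp_add]
    calc (n : ℝ) = Real.exp (Real.log n) := (Real.exp_log hn).symm
      _ < Real.exp (c + 1 * (ell D ^ 10)⁻¹) := Real.exp_lt_exp.mpr (by linarith)

/-- The true-size engine with its absolute constant packaged existentially:
`‖S_j(𝐚₁,𝐚₂)‖ ≤ C_S·B₁B₂·𝓛²⁷` for ANY termwise bounded `𝐚₁, 𝐚₂` once `D ≥ ⌈e^{5|c′|π+3}⌉`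
(tree `XiZeroMajorant.norm_Sj_le_of_bounds`, p477106). [cite: Zhang2022LandauSiegel, §11 p.64] -/
private theorem engine0 : ∃ C : ℝ, 0 ≤ C ∧ ∀ (c' : ℝ) (D : ℕ),
    ⌈Real.exp (5 * |c'| * π + 3)⌉₊ ≤ D → ∀ (j : ℕ) (a₁ a₂ : ℕ → ℂ) (B₁ B₂ : ℝ),
      (∀ n, ‖a₁ n‖ ≤ B₁) → (∀ n, ‖a₂ n‖ ≤ B₂) →
        ‖Sj c' D j a₁ a₂‖ ≤ C * B₁ * B₂ * ell D ^ 27 := by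
  refine ⟨4 * Real.exp (4 + LogEulerProduct.tailConst 0) *
      Real.exp (16 + 7 * LogEulerProduct.tailConst 0) *
      Real.exp (28 + 14 * LogEulerProduct.tailConst 0) *
      (3 * Real.exp (4 + 1134 * π + (12 + 56 * LogEulerProduct.tailConst 3) +
        7 * (2 + LogEulerProduct.tailConst 3) * LogEulerProduct.tailConst 4)),
    by positivity, fun c' D hD j a₁ a₂ B₁ B₂ h₁ h₂ => ?_⟩
  exact XiZeroMajorant.norm_Sj_le_of_bounds hD j h₁ h₂

/-! ### The generic eight-pair bookkeeping -/

/-- **Three-piece bookkeeping for `S_j(𝐚,𝐚̄)` (generic).** There are an absolute `K ≥ 0` and, for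
every `c′`, a threshold `D₀` such that for `D ≥ D₀`, every `j`, any two centres `0 < x₁, x₂ ≤ P`
and any decomposition `𝐚 = 𝐚_in + 𝐚_near + 𝐚_far` (termwise) with `‖𝐚_in‖ ≤ B₀`,
`‖𝐚_near‖ ≤ B₁`, `‖𝐚_far‖ ≤ B₂`, where `𝐚_in` and `𝐚_near` are supported in the union of the two
`η`-windows `(xᵢη₋, xᵢη₊)`:

  `‖S_j(𝐚,𝐚̄) − S_j(𝐚_in,𝐚̄_in)‖ ≤ K·(B₀B₁·𝓛⁸ + B₀B₂·𝓛²⁷ + (B₁+B₂)²·𝓛²⁷)`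

(`𝐚̄ = conj ∘ 𝐚`). The pairs `(in,near)`, `(near,in)` are priced by the tree's window bound
`WindowSj.norm_Sj_window_le` (p477114, `≤ C·#xs²·B·B′·𝓛⁸`, `#xs ≤ 2`), the pairs
`(in,far)`, `(far,in)` and the block `(near+far, near+far)` by the true-size bound
`XiZeroMajorant.norm_Sj_le_of_bounds` (p477106, `≤ C_S·B·B′·𝓛²⁷`); `S_j` is bilinear
(`Section7SjBilinear`). [cite: Zhang2022LandauSiegel, §12 p.67; §11 p.64] -/
theorem norm_Sj_conj_sub_inner_le : ∃ K : ℝ, 0 ≤ K ∧ ∀ c' : ℝ, ∃ D₀ : ℕ, ∀ D : ℕ, D₀ ≤ D →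
    ∀ (j : ℕ) (x₁ x₂ : ℝ), 0 < x₁ → x₁ ≤ bigP D → 0 < x₂ → x₂ ≤ bigP D →
    ∀ (B₀ B₁ B₂ : ℝ) (a aIn aNear aFar : ℕ → ℂ),
      (∀ n, a n = aIn n + aNear n + aFar n) →
      (∀ n, ‖aIn n‖ ≤ B₀) → (∀ n, ‖aNear n‖ ≤ B₁) → (∀ n, ‖aFar n‖ ≤ B₂) →
      (∀ n, aIn n ≠ 0 →
        (x₁ * etaPM D (-1) < n ∧ (n : ℝ) < x₁ * etaPM D 1) ∨
          (x₂ * etaPM D (-1) < n ∧ (n : ℝ) < x₂ * etaPM D 1)) →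
      (∀ n, aNear n ≠ 0 →
        (x₁ * etaPM D (-1) < n ∧ (n : ℝ) < x₁ * etaPM D 1) ∨
          (x₂ * etaPM D (-1) < n ∧ (n : ℝ) < x₂ * etaPM D 1)) →
      ‖Sj c' D j a (fun n => conj (a n)) - Sj c' D j aIn (fun n => conj (aIn n))‖ ≤
        K * (B₀ * B₁ * ell D ^ 8 + B₀ * B₂ * ell D ^ 27 + (B₁ + B₂) ^ 2 * ell D ^ 27) := by
  obtain ⟨CS, hCS0, hS⟩ := engine0
  obtain ⟨CW, hCW0, hW⟩ := WindowSj.norm_Sj_window_le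
  refine ⟨8 * CW + 2 * CS, by positivity, fun c' => ?_⟩
  obtain ⟨DW, hWD⟩ := hW c'
  refine ⟨max DW ⌈Real.exp (5 * |c'| * π + 3)⌉₊, fun D hD j x₁ x₂ hx₁ hx₁P hx₂ hx₂P B₀ B₁ B₂
    a aIn aNear aFar hsum hIn hNear hFar hsIn hsNear => ?_⟩
  have hDW : DW ≤ D := le_trans (le_max_left _ _) hD
  have hDS : ⌈Real.exp (5 * |c'| * π + 3)⌉₊ ≤ D := le_trans (le_max_right _ _) hD
  have hB₀ : 0 ≤ B₀ := le_trans (norm_nonneg _) (hIn 0)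
  have hB₁ : 0 ≤ B₁ := le_trans (norm_nonneg _) (hNear 0)
  have hB₂ : 0 ≤ B₂ := le_trans (norm_nonneg _) (hFar 0)
  have hℓ0 : 0 ≤ ell D := by
    have h3 : 5 * |c'| * π + 3 ≤ ell D := le_ell_of_ceil_exp_le_pieces hDS
    nlinarith [abs_nonneg c', Real.pi_pos]
  -- the conjugate pieces
  set gIn : ℕ → ℂ := fun n => conj (aIn n) with hgIn
  set gNear : ℕ → ℂ := fun n => conj (aNear n) with hgNear
  set gFar : ℕ → ℂ := fun n => conj (aFar n) with hgFar
  have hgInB : ∀ n, ‖gIn n‖ ≤ B₀ := fun n => by rw [hgIn, Complex.norm_conj]; exact hIn n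
  have hgNearB : ∀ n, ‖gNear n‖ ≤ B₁ := fun n => by rw [hgNear, Complex.norm_conj]; exact hNear n
  have hgFarB : ∀ n, ‖gFar n‖ ≤ B₂ := fun n => by rw [hgFar, Complex.norm_conj]; exact hFar n
  have hOutB : ∀ n, ‖(aNear + aFar) n‖ ≤ B₁ + B₂ := fun n => by
    rw [Pi.add_apply]; exact le_trans (norm_add_le _ _) (add_le_add (hNear n) (hFar n))
  have hgOutB : ∀ n, ‖(gNear + gFar) n‖ ≤ B₁ + B₂ := fun n => by
    rw [Pi.add_apply]; exact le_trans (norm_add_le _ _) (add_le_add (hgNearB n) (hgFarB n))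
  -- supports of the conjugate pieces
  have hsgIn : ∀ n, gIn n ≠ 0 →
      (x₁ * etaPM D (-1) < n ∧ (n : ℝ) < x₁ * etaPM D 1) ∨
        (x₂ * etaPM D (-1) < n ∧ (n : ℝ) < x₂ * etaPM D 1) := fun n h => by
    refine hsIn n fun h0 => h ?_
    rw [hgIn]; simp [h0]
  have hsgNear : ∀ n, gNear n ≠ 0 →
      (x₁ * etaPM D (-1) < n ∧ (n : ℝ) < x₁ * etaPM D 1) ∨
        (x₂ * etaPM D (-1) < n ∧ (n : ℝ) < x₂ * etaPM D 1) := fun n h => by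
    refine hsNear n fun h0 => h ?_
    rw [hgNear]; simp [h0]
  -- the algebraic decomposition
  have ha : a = aIn + (aNear + aFar) := by
    funext n; simp only [Pi.add_apply, hsum n, add_assoc]
  have hg : (fun n => conj (a n)) = gIn + (gNear + gFar) := by
    funext n; simp only [Pi.add_apply, hgIn, hgNear, hgFar, hsum n, map_add, add_assoc]
  have hdec : Sj c' D j a (fun n => conj (a n)) - Sj c' D j aIn gIn =
      (Sj c' D j aIn gNear + Sj c' D j aIn gFar) +
        (Sj c' D j aNear gIn + Sj c' D j aFar gIn) +
        Sj c' D j (aNear + aFar) (gNear + gFar) := by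
    rw [hg, ha, Skeleton.Sj_add_add, Skeleton.Sj_add_right c' D j aIn gNear gFar,
      Skeleton.Sj_add_left c' D j aNear aFar gIn]
    ring
  -- the window engine data
  set xs : Finset ℝ := {x₁, x₂} with hxs
  have hxsP : ∀ x ∈ xs, 0 < x ∧ x ≤ bigP D := by
    intro x hx
    rw [hxs, Finset.mem_insert, Finset.mem_singleton] at hx
    rcases hx with rfl | rfl
    · exact ⟨hx₁, hx₁P⟩
    · exact ⟨hx₂, hx₂P⟩
  have hcard : (xs.card : ℝ) ≤ 2 := by
    rw [hxs]; exact_mod_cast Finset.card_le_two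
  have hmem : ∀ n : ℕ,
      ((x₁ * etaPM D (-1) < n ∧ (n : ℝ) < x₁ * etaPM D 1) ∨
        (x₂ * etaPM D (-1) < n ∧ (n : ℝ) < x₂ * etaPM D 1)) →
      ∃ x ∈ xs, x * etaPM D (-1) < n ∧ (n : ℝ) < x * etaPM D 1 := by
    intro n h
    rcases h with h | h
    · exact ⟨x₁, by rw [hxs]; simp, h⟩
    · exact ⟨x₂, by rw [hxs]; simp, h⟩
  have hW2 : CW * (xs.card : ℝ) ^ 2 ≤ CW * 4 := by
    have : (xs.card : ℝ) ^ 2 ≤ 2 ^ 2 := by gcongr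
    nlinarith
  -- the five bounds
  have h1 : ‖Sj c' D j aIn gNear‖ ≤ 4 * CW * B₀ * B₁ * ell D ^ 8 := by
    have h := hWD D hDW j xs hxsP B₀ B₁ hB₀ hB₁ aIn gNear hIn hgNearB
      (fun n hn => hmem n (hsIn n hn)) (fun n hn => hmem n (hsgNear n hn))
    calc ‖Sj c' D j aIn gNear‖ ≤ CW * (xs.card : ℝ) ^ 2 * B₀ * B₁ * ell D ^ 8 := h
      _ ≤ CW * 4 * B₀ * B₁ * ell D ^ 8 := by gcongr
      _ = 4 * CW * B₀ * B₁ * ell D ^ 8 := by ring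
  have h2 : ‖Sj c' D j aNear gIn‖ ≤ 4 * CW * B₀ * B₁ * ell D ^ 8 := by
    have h := hWD D hDW j xs hxsP B₁ B₀ hB₁ hB₀ aNear gIn hNear hgInB
      (fun n hn => hmem n (hsNear n hn)) (fun n hn => hmem n (hsgIn n hn))
    calc ‖Sj c' D j aNear gIn‖ ≤ CW * (xs.card : ℝ) ^ 2 * B₁ * B₀ * ell D ^ 8 := h
      _ ≤ CW * 4 * B₁ * B₀ * ell D ^ 8 := by gcongr
      _ = 4 * CW * B₀ * B₁ * ell D ^ 8 := by ring
  have h3 : ‖Sj c' D j aIn gFar‖ ≤ CS * B₀ * B₂ * ell D ^ 27 :=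
    hS c' D hDS j aIn gFar B₀ B₂ hIn hgFarB
  have h4 : ‖Sj c' D j aFar gIn‖ ≤ CS * B₀ * B₂ * ell D ^ 27 := by
    have h := hS c' D hDS j aFar gIn B₂ B₀ hFar hgInB
    calc ‖Sj c' D j aFar gIn‖ ≤ CS * B₂ * B₀ * ell D ^ 27 := h
      _ = CS * B₀ * B₂ * ell D ^ 27 := by ring
  have h5 : ‖Sj c' D j (aNear + aFar) (gNear + gFar)‖ ≤ CS * (B₁ + B₂) * (B₁ + B₂) * ell D ^ 27 :=
    hS c' D hDS j (aNear + aFar) (gNear + gFar) (B₁ + B₂) (B₁ + B₂) hOutB hgOutB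
  -- assemble
  have hℓ8 : 0 ≤ ell D ^ 8 := pow_nonneg hℓ0 8
  have hℓ27 : 0 ≤ ell D ^ 27 := pow_nonneg hℓ0 27
  rw [hdec]
  calc ‖(Sj c' D j aIn gNear + Sj c' D j aIn gFar) +
          (Sj c' D j aNear gIn + Sj c' D j aFar gIn) +
          Sj c' D j (aNear + aFar) (gNear + gFar)‖
      ≤ (‖Sj c' D j aIn gNear‖ + ‖Sj c' D j aIn gFar‖) +
          (‖Sj c' D j aNear gIn‖ + ‖Sj c' D j aFar gIn‖) +
          ‖Sj c' D j (aNear + aFar) (gNear + gFar)‖ := by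
        refine le_trans (norm_add_le _ _) (add_le_add (le_trans (norm_add_le _ _)
          (add_le_add (norm_add_le _ _) (norm_add_le _ _))) le_rfl)
    _ ≤ (4 * CW * B₀ * B₁ * ell D ^ 8 + CS * B₀ * B₂ * ell D ^ 27) +
          (4 * CW * B₀ * B₁ * ell D ^ 8 + CS * B₀ * B₂ * ell D ^ 27) +
          CS * (B₁ + B₂) * (B₁ + B₂) * ell D ^ 27 := by
        gcongr
    _ = (8 * CW) * (B₀ * B₁ * ell D ^ 8) + (2 * CS) * (B₀ * B₂ * ell D ^ 27) +
          CS * ((B₁ + B₂) ^ 2 * ell D ^ 27) := by ring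
    _ ≤ (8 * CW + 2 * CS) * (B₀ * B₁ * ell D ^ 8) + (8 * CW + 2 * CS) * (B₀ * B₂ * ell D ^ 27) +
          (8 * CW + 2 * CS) * ((B₁ + B₂) ^ 2 * ell D ^ 27) := by
        have hT1 : 0 ≤ B₀ * B₁ * ell D ^ 8 := by positivity
        have hT2 : 0 ≤ B₀ * B₂ * ell D ^ 27 := by positivity
        have hT3 : 0 ≤ (B₁ + B₂) ^ 2 * ell D ^ 27 := by positivity
        have hK1 : 8 * CW ≤ 8 * CW + 2 * CS := by linarith
        have hK2 : 2 * CS ≤ 8 * CW + 2 * CS := by linarith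
        have hK3 : CS ≤ 8 * CW + 2 * CS := by linarith
        gcongr
    _ = (8 * CW + 2 * CS) *
          (B₀ * B₁ * ell D ^ 8 + B₀ * B₂ * ell D ^ 27 + (B₁ + B₂) ^ 2 * ell D ^ 27) := by ring

/-! ### The (12.6) coefficient sequence and its three pieces (data abbreviations) -/

section Literal

variable (D : ℕ) (χ : DirichletCharacter ℂ D)

/-- **Data abbreviation**: the literal (12.6) coefficient sequence `𝐛` of `eq126_of_sj_small`
(`H₁₅ − H̃₁₅`, §12 p. 66): `𝐛(n) = χ(n)(ϰ₁(n)𝟙[P^{1/2} ≤ n < ⌈P₁⌉] − ϰ₁₂(n)𝟙[P^{0.5}η₋ < n < P₁η₊])`.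
An abbreviation of a printed object, not a claim. [cite: Zhang2022LandauSiegel, §12 (12.6) p.66] -/
def b126 (n : ℕ) : ℂ :=
  (if n ∈ (Finset.Ico 1 ⌈Skeleton.P1 D⌉₊).filter
        (fun n : ℕ => ¬ (n : ℝ) < bigP D ^ (1 / 2 : ℝ))
    then χ (n : ZMod D) * vk1 D n else 0) -
  (if n ∈ (Finset.Ico 1 ⌈Skeleton.P1 D * etaPM D 1⌉₊).filter
        (fun n : ℕ => bigP D ^ (0.5 : ℝ) * etaPM D (-1) < n ∧
          (n : ℝ) < Skeleton.P1 D * etaPM D 1)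
    then χ (n : ZMod D) * vk12 D n else 0)

/-- **Data abbreviation**: the INNER piece `𝐛_in := 𝐛·𝟙[|log n − 𝓛⁹/2| < 𝓛⁻¹⁴]` (the `O(1)`
part of the (12.6) sequence, sup `≤ 0.005`, relative width `2𝓛⁻¹⁴` around `P^{1/2}`).
[cite: Zhang2022LandauSiegel, §12 (12.6) p.67] -/
def b126In (n : ℕ) : ℂ :=
  if |Real.log n - ell D ^ 9 / 2| < (ell D ^ 14)⁻¹ then b126 D χ n else 0

/-- **Data abbreviation**: the NEAR piece `𝐛_near := 𝐛·𝟙[¬IN ∧ (|log n − 𝓛⁹/2| < 𝓛⁻¹⁰ ∨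
|log n − 0.504𝓛⁹| < 𝓛⁻¹⁰)]` (the rest of the two `η`-windows around `P^{1/2}` and `P₁`; sup
`O(𝓛⁻²⁴)`). [cite: Zhang2022LandauSiegel, §12 (12.6) p.67] -/
def b126Near (n : ℕ) : ℂ :=
  if |Real.log n - ell D ^ 9 / 2| < (ell D ^ 14)⁻¹ then 0 else
    if |Real.log n - ell D ^ 9 / 2| < (ell D ^ 10)⁻¹ ∨
        |Real.log n - 0.504 * ell D ^ 9| < (ell D ^ 10)⁻¹ then b126 D χ n else 0

/-- **Data abbreviation**: the FAR piece `𝐛_far := 𝐛·𝟙[¬IN ∧ ¬(|log n − 𝓛⁹/2| < 𝓛⁻¹⁰ ∨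
|log n − 0.504𝓛⁹| < 𝓛⁻¹⁰)]` (log-distance `≥ 𝓛⁻¹⁰` from both `P^{1/2}` and `P₁`; sup
`O(e^{−𝓛¹⁰})`). [cite: Zhang2022LandauSiegel, §12 (12.6) p.67] -/
def b126Far (n : ℕ) : ℂ :=
  if |Real.log n - ell D ^ 9 / 2| < (ell D ^ 14)⁻¹ then 0 else
    if |Real.log n - ell D ^ 9 / 2| < (ell D ^ 10)⁻¹ ∨
        |Real.log n - 0.504 * ell D ^ 9| < (ell D ^ 10)⁻¹ then 0 else b126 D χ n

/-- `S_j(𝐛,𝐛̄)` with the abbreviation `b126` IS the literal pair of arguments of the `hS` binder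
of `eq126_of_sj_small` (by `rfl`). [cite: Zhang2022LandauSiegel, §12 (12.6) p.67] -/
theorem Sj_b126_eq (c' : ℝ) (j : ℕ) :
    Sj c' D j (b126 D χ) (fun n : ℕ => conj (b126 D χ n)) =
      Sj c' D j
        (fun n : ℕ =>
          (if n ∈ (Finset.Ico 1 ⌈Skeleton.P1 D⌉₊).filter
                (fun n : ℕ => ¬ (n : ℝ) < bigP D ^ (1 / 2 : ℝ))
            then χ (n : ZMod D) * vk1 D n else 0) -
          (if n ∈ (Finset.Ico 1 ⌈Skeleton.P1 D * etaPM D 1⌉₊).filter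
                (fun n : ℕ => bigP D ^ (0.5 : ℝ) * etaPM D (-1) < n ∧
                  (n : ℝ) < Skeleton.P1 D * etaPM D 1)
            then χ (n : ZMod D) * vk12 D n else 0))
        (fun n : ℕ => conj (
          (if n ∈ (Finset.Ico 1 ⌈Skeleton.P1 D⌉₊).filter
                (fun n : ℕ => ¬ (n : ℝ) < bigP D ^ (1 / 2 : ℝ))
            then χ (n : ZMod D) * vk1 D n else 0) -
          (if n ∈ (Finset.Ico 1 ⌈Skeleton.P1 D * etaPM D 1⌉₊).filter
                (fun n : ℕ => bigP D ^ (0.5 : ℝ) * etaPM D (-1) < n ∧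
                  (n : ℝ) < Skeleton.P1 D * etaPM D 1)
            then χ (n : ZMod D) * vk12 D n else 0))) := rfl

/-- **The three-piece decomposition** `𝐛 = 𝐛_in + 𝐛_near + 𝐛_far` (termwise; the three
predicates IN / NEAR / FAR partition `ℕ`). [cite: Zhang2022LandauSiegel, §12 (12.6) p.67] -/
theorem b126_decomp (n : ℕ) : b126 D χ n = b126In D χ n + b126Near D χ n + b126Far D χ n := by
  unfold b126In b126Near b126Far
  by_cases hI : |Real.log n - ell D ^ 9 / 2| < (ell D ^ 14)⁻¹
  · simp [hI]
  · by_cases hW : |Real.log n - ell D ^ 9 / 2| < (ell D ^ 10)⁻¹ ∨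
        |Real.log n - 0.504 * ell D ^ 9| < (ell D ^ 10)⁻¹
    · simp [hI, hW]
    · simp [hI, hW]

variable {D}

/-- **`𝐛 ≠ 0` only on the window `P^{0.5}η₋ < n < P₁η₊`** (`D ≥ 2`; contrapositive of the tree's
`b126_eq_zero_of_not_window`). [cite: Zhang2022LandauSiegel, §12 (12.6) p.66] -/
theorem window_of_b126_ne_zero (hD : 2 ≤ D) {n : ℕ} (h : b126 D χ n ≠ 0) :
    bigP D ^ (0.5 : ℝ) * etaPM D (-1) < n ∧ (n : ℝ) < Skeleton.P1 D * etaPM D 1 := by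
  by_contra hn
  exact h (b126_eq_zero_of_not_window χ hD hn)

/-- `𝐛 n ≠ 0 ⇒ n > 0` (as a real number; `D ≥ 2`). [cite: Zhang2022LandauSiegel, §12 (12.6) p.66] -/
theorem cast_pos_of_b126_ne_zero (hD : 2 ≤ D) {n : ℕ} (h : b126 D χ n ≠ 0) : 0 < (n : ℝ) := by
  have hw := (window_of_b126_ne_zero χ hD h).1
  have h0 : 0 < bigP D ^ (0.5 : ℝ) * etaPM D (-1) :=
    mul_pos (Real.rpow_pos_of_pos (Real.exp_pos _) _) (Real.exp_pos _)
  linarith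

/-- `𝐛 0 = 0` (`D ≥ 2`). [cite: Zhang2022LandauSiegel, §12 (12.6) p.66] -/
theorem b126_zero (hD : 2 ≤ D) : b126 D χ 0 = 0 := by
  by_contra h
  have := cast_pos_of_b126_ne_zero χ hD h
  simp at this

/-- **Sup of the inner piece**: `‖𝐛_in n‖ ≤ 0.005` (`D ≥ 2`, `𝓛 ≥ 2`; tree
`norm_b126_le_global`). [cite: Zhang2022LandauSiegel, §12 p.67 (tex L3408, "≪ 1")] -/
theorem norm_b126In_le (hD : 2 ≤ D) (hL : 2 ≤ ell D) (n : ℕ) : ‖b126In D χ n‖ ≤ 0.005 := by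
  unfold b126In
  split_ifs
  · exact norm_b126_le_global χ hD hL n
  · rw [norm_zero]; norm_num

/-- **Sup of the near piece**: `‖𝐛_near n‖ ≤ 2·10⁶·𝓛⁻²⁴` (`D ≥ 2`, `𝓛 ≥ 1`). Off the inner window
the tree's `norm_b126_le_of_far_half` (`w = 𝓛⁻¹⁴`) gives `2𝓛⁻²⁴ + 0.004e^{−𝓛²}`, and
`e^{−𝓛²} ≤ 12!/𝓛²⁴`. [cite: Zhang2022LandauSiegel, §12 p.67 (tex L3408)] -/
theorem norm_b126Near_le (hD : 2 ≤ D) (hL : 1 ≤ ell D) (n : ℕ) :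
    ‖b126Near D χ n‖ ≤ 2000000 * (ell D ^ 24)⁻¹ := by
  have hℓ : 0 < ell D := by linarith
  have h24 : 0 < (ell D ^ 24)⁻¹ := inv_pos.mpr (pow_pos hℓ 24)
  unfold b126Near
  by_cases hI : |Real.log n - ell D ^ 9 / 2| < (ell D ^ 14)⁻¹
  · rw [if_pos hI, norm_zero]; positivity
  rw [if_neg hI]
  split_ifs with hW
  · rcases Nat.eq_zero_or_pos n with rfl | hn
    · rw [b126_zero χ hD, norm_zero]; positivity
    have h1 : (ell D ^ 14)⁻¹ ≤ |Real.log n - ell D ^ 9 / 2| := not_lt.mp hI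
    have hb := norm_b126_le_of_far_half χ hD hn (w := (ell D ^ 14)⁻¹) (by positivity) h1
    have hexp : Real.exp (-(ell D ^ 30) * ((ell D ^ 14)⁻¹) ^ 2) ≤
        ((12 : ℕ).factorial : ℝ) * (ell D ^ 24)⁻¹ := by
      have he : -(ell D ^ 30) * ((ell D ^ 14)⁻¹) ^ 2 = -(ell D ^ 2) := by
        field_simp
      rw [he]
      have h := exp_neg_le_factorial_div (pow_pos hℓ 2) 12
      calc Real.exp (-(ell D ^ 2)) ≤ ((12 : ℕ).factorial : ℝ) / (ell D ^ 2) ^ 12 := h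
        _ = ((12 : ℕ).factorial : ℝ) * (ell D ^ 24)⁻¹ := by rw [← pow_mul, div_eq_mul_inv]
    have hfac : ((12 : ℕ).factorial : ℝ) = 479001600 := by norm_num [Nat.factorial]
    rw [hfac] at hexp
    change ‖b126 D χ n‖ ≤ _
    unfold b126
    calc _ ≤ 2 * (ell D ^ 24)⁻¹ + 0.004 * Real.exp (-(ell D ^ 30) * ((ell D ^ 14)⁻¹) ^ 2) := hb
      _ ≤ 2 * (ell D ^ 24)⁻¹ + 0.004 * (479001600 * (ell D ^ 24)⁻¹) := by gcongr
      _ ≤ 2000000 * (ell D ^ 24)⁻¹ := by nlinarith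
  · rw [norm_zero]; positivity

/-- **Sup of the far piece**: `‖𝐛_far n‖ ≤ 0.192·𝓛⁻⁴⁰` (`D ≥ 2`, `𝓛 ≥ 1`). At log-distance
`≥ 𝓛⁻¹⁰` from both `P^{1/2}` and `P₁` the tree's `norm_b126_le_far` (`w = 𝓛⁻¹⁰`) gives
`0.008e^{−𝓛¹⁰}`, and `e^{−𝓛¹⁰} ≤ 4!/𝓛⁴⁰`. [cite: Zhang2022LandauSiegel, §12 p.67 (tex L3404)] -/
theorem norm_b126Far_le (hD : 2 ≤ D) (hL : 1 ≤ ell D) (n : ℕ) :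
    ‖b126Far D χ n‖ ≤ 0.192 * (ell D ^ 40)⁻¹ := by
  have hℓ : 0 < ell D := by linarith
  have h40 : 0 < (ell D ^ 40)⁻¹ := inv_pos.mpr (pow_pos hℓ 40)
  unfold b126Far
  by_cases hI : |Real.log n - ell D ^ 9 / 2| < (ell D ^ 14)⁻¹
  · rw [if_pos hI, norm_zero]; positivity
  rw [if_neg hI]
  split_ifs with hW
  · rw [norm_zero]; positivity
  · rcases Nat.eq_zero_or_pos n with rfl | hn
    · rw [b126_zero χ hD, norm_zero]; positivity
    have h1 : (ell D ^ 10)⁻¹ ≤ |Real.log n - ell D ^ 9 / 2| := not_lt.mp fun h => hW (Or.inl h)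
    have h2 : (ell D ^ 10)⁻¹ ≤ |Real.log n - 0.504 * ell D ^ 9| :=
      not_lt.mp fun h => hW (Or.inr h)
    have hb := norm_b126_le_far χ hD hn (w := (ell D ^ 10)⁻¹) (by positivity) h1 h2
    have hexp : Real.exp (-(ell D ^ 30) * ((ell D ^ 10)⁻¹) ^ 2) ≤
        ((4 : ℕ).factorial : ℝ) * (ell D ^ 40)⁻¹ := by
      have he : -(ell D ^ 30) * ((ell D ^ 10)⁻¹) ^ 2 = -(ell D ^ 10) := by
        field_simp
      rw [he]
      have h := exp_neg_le_factorial_div (pow_pos hℓ 10) 4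
      calc Real.exp (-(ell D ^ 10)) ≤ ((4 : ℕ).factorial : ℝ) / (ell D ^ 10) ^ 4 := h
        _ = ((4 : ℕ).factorial : ℝ) * (ell D ^ 40)⁻¹ := by rw [← pow_mul, div_eq_mul_inv]
    have hfac : ((4 : ℕ).factorial : ℝ) = 24 := by norm_num [Nat.factorial]
    rw [hfac] at hexp
    change ‖b126 D χ n‖ ≤ _
    unfold b126
    calc _ ≤ 0.008 * Real.exp (-(ell D ^ 30) * ((ell D ^ 10)⁻¹) ^ 2) := hb
      _ ≤ 0.008 * (24 * (ell D ^ 40)⁻¹) := by gcongr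
      _ = 0.192 * (ell D ^ 40)⁻¹ := by ring

/-- **Support of the inner piece**: `𝐛_in n ≠ 0 ⇒ P^{1/2}η₋ < n < P^{1/2}η₊` (`P^{1/2} = e^{𝓛⁹/2}`;
`D ≥ 2`, `𝓛 ≥ 1`). [cite: Zhang2022LandauSiegel, §12 (12.6) p.67] -/
theorem window_of_b126In_ne_zero (hD : 2 ≤ D) (hL : 1 ≤ ell D) {n : ℕ} (h : b126In D χ n ≠ 0) :
    Real.exp (ell D ^ 9 / 2) * etaPM D (-1) < n ∧ (n : ℝ) < Real.exp (ell D ^ 9 / 2) * etaPM D 1 := by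
  unfold b126In at h
  by_cases hI : |Real.log n - ell D ^ 9 / 2| < (ell D ^ 14)⁻¹
  · rw [if_pos hI] at h
    have hn := cast_pos_of_b126_ne_zero χ hD h
    have hδ : (ell D ^ 14)⁻¹ ≤ (ell D ^ 10)⁻¹ := by
      have hℓ : 0 < ell D := by linarith
      exact inv_anti₀ (pow_pos hℓ 10) (pow_le_pow_right₀ hL (by norm_num))
    exact window_of_abs_log_lt hn hδ hI
  · rw [if_neg hI] at h; exact absurd rfl h

/-- **Support of the near piece**: `𝐛_near n ≠ 0 ⇒` `n` lies in the `η`-window around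
`P^{1/2} = e^{𝓛⁹/2}` or in the one around `P₁ = e^{0.504𝓛⁹}` (`D ≥ 2`).
[cite: Zhang2022LandauSiegel, §12 (12.6) p.67] -/
theorem window_of_b126Near_ne_zero (hD : 2 ≤ D) {n : ℕ} (h : b126Near D χ n ≠ 0) :
    (Real.exp (ell D ^ 9 / 2) * etaPM D (-1) < n ∧
        (n : ℝ) < Real.exp (ell D ^ 9 / 2) * etaPM D 1) ∨
      (Real.exp (0.504 * ell D ^ 9) * etaPM D (-1) < n ∧
        (n : ℝ) < Real.exp (0.504 * ell D ^ 9) * etaPM D 1) := by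
  unfold b126Near at h
  by_cases hI : |Real.log n - ell D ^ 9 / 2| < (ell D ^ 14)⁻¹
  · rw [if_pos hI] at h; exact absurd rfl h
  rw [if_neg hI] at h
  by_cases hW : |Real.log n - ell D ^ 9 / 2| < (ell D ^ 10)⁻¹ ∨
      |Real.log n - 0.504 * ell D ^ 9| < (ell D ^ 10)⁻¹
  · rw [if_pos hW] at h
    have hn := cast_pos_of_b126_ne_zero χ hD h
    rcases hW with hW | hW
    · exact Or.inl (window_of_abs_log_lt hn le_rfl hW)
    · exact Or.inr (window_of_abs_log_lt hn le_rfl hW)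
  · rw [if_neg hW] at h; exact absurd rfl h

end Literal

/-! ### The reduction of `hS` to the inner core -/

/-- The numerical budget of the eight non-core pairs: for `𝓛 ≥ 1`,
`0.005·(2·10⁶𝓛⁻²⁴)·𝓛⁸ + 0.005·(0.192𝓛⁻⁴⁰)·𝓛²⁷ + (2·10⁶𝓛⁻²⁴ + 0.192𝓛⁻⁴⁰)²·𝓛²⁷ ≤ 5·10¹²·𝓛⁻¹³`.
[folklore] -/
private theorem pieces_budget {ℓ : ℝ} (hℓ : 1 ≤ ℓ) :
    0.005 * (2000000 * (ℓ ^ 24)⁻¹) * ℓ ^ 8 + 0.005 * (0.192 * (ℓ ^ 40)⁻¹) * ℓ ^ 27 +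
        (2000000 * (ℓ ^ 24)⁻¹ + 0.192 * (ℓ ^ 40)⁻¹) ^ 2 * ℓ ^ 27 ≤
      5000000000000 * (ℓ ^ 13)⁻¹ := by
  have hℓ0 : 0 < ℓ := by linarith
  have hℓne : ℓ ≠ 0 := hℓ0.ne'
  have hmono : ∀ a b : ℕ, a ≤ b → (ℓ ^ b)⁻¹ ≤ (ℓ ^ a)⁻¹ := fun a b hab =>
    inv_anti₀ (pow_pos hℓ0 a) (pow_le_pow_right₀ hℓ hab)
  -- term 1
  have t1 : 0.005 * (2000000 * (ℓ ^ 24)⁻¹) * ℓ ^ 8 ≤ 10000 * (ℓ ^ 13)⁻¹ := by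
    have e : 0.005 * (2000000 * (ℓ ^ 24)⁻¹) * ℓ ^ 8 = 10000 * (ℓ ^ 16)⁻¹ := by
      field_simp; ring
    rw [e]
    exact mul_le_mul_of_nonneg_left (hmono 13 16 (by norm_num)) (by norm_num)
  -- term 2
  have t2 : 0.005 * (0.192 * (ℓ ^ 40)⁻¹) * ℓ ^ 27 ≤ 1 * (ℓ ^ 13)⁻¹ := by
    have e : 0.005 * (0.192 * (ℓ ^ 40)⁻¹) * ℓ ^ 27 = 0.00096 * (ℓ ^ 13)⁻¹ := by
      field_simp; ring
    rw [e]
    exact mul_le_mul_of_nonneg_right (by norm_num) (by positivity)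
  -- term 3
  have t3 : (2000000 * (ℓ ^ 24)⁻¹ + 0.192 * (ℓ ^ 40)⁻¹) ^ 2 * ℓ ^ 27 ≤
      2000001 ^ 2 * (ℓ ^ 13)⁻¹ := by
    have hs : 2000000 * (ℓ ^ 24)⁻¹ + 0.192 * (ℓ ^ 40)⁻¹ ≤ 2000001 * (ℓ ^ 24)⁻¹ := by
      have := hmono 24 40 (by norm_num)
      nlinarith [inv_pos.mpr (pow_pos hℓ0 24)]
    have hs0 : 0 ≤ 2000000 * (ℓ ^ 24)⁻¹ + 0.192 * (ℓ ^ 40)⁻¹ := by positivity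
    calc (2000000 * (ℓ ^ 24)⁻¹ + 0.192 * (ℓ ^ 40)⁻¹) ^ 2 * ℓ ^ 27
        ≤ (2000001 * (ℓ ^ 24)⁻¹) ^ 2 * ℓ ^ 27 := by gcongr
      _ = 2000001 ^ 2 * (ℓ ^ 21)⁻¹ := by field_simp
      _ ≤ 2000001 ^ 2 * (ℓ ^ 13)⁻¹ :=
          mul_le_mul_of_nonneg_left (hmono 13 21 (by norm_num)) (by norm_num)
  have h13 : 0 ≤ (ℓ ^ 13)⁻¹ := by positivity
  nlinarith

/-- **`hS` of (12.6) FROM ITS INNER CORE.** If, for every `ε > 0`, eventually under (A),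
`‖S_j(𝐛_in,𝐛̄_in)‖ ≤ ε·α·𝔞` (`j = 1,2,3`) for the inner piece `𝐛_in = 𝐛·𝟙[|log n − 𝓛⁹/2| < 𝓛⁻¹⁴]`
(`b126In`), then the window estimate `hS` of `Typed.Sec12A.eq126_of_sj_small` holds LITERALLY:
`‖S_j(𝐛,𝐛̄)‖ ≤ ε·α·𝔞` eventually under (A). The eight non-core pairs of the bilinear expansion
along `𝐛 = 𝐛_in + 𝐛_near + 𝐛_far` are `O(𝓛⁻¹³) = o(α𝔞)` by `norm_Sj_conj_sub_inner_le`
(window bound p477114 for the two `(in,near)` pairs, true-size bound p477106 for the rest), the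
sharp profile p478648, `α = π𝓛⁻⁹` and `𝔞 ≥ a₀` (`frakALowerBound_holds`). This is the
(8.25)/(8.26)-type estimate v1 invokes at §12 p. 67 without proof, reduced to its core; nothing
about Landau–Siegel zeros follows. [cite: Zhang2022LandauSiegel, §12 (12.6) p.67; §11 p.64] -/
theorem Sj_h15_window_small_of_inner (c' : ℝ)
    (hIn : ∀ ε : ℝ, 0 < ε → ForAllLarge fun D _ χ => AssumptionA D χ →
      ∀ j ∈ ({1, 2, 3} : Finset ℕ),
        ‖Sj c' D j (b126In D χ) (fun n : ℕ => conj (b126In D χ n))‖ ≤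
          ε * alpha D * frakA χ) :
    ∀ ε : ℝ, 0 < ε → ForAllLarge fun D _ χ => AssumptionA D χ →
      ∀ j ∈ ({1, 2, 3} : Finset ℕ),
        ‖Sj c' D j
            (fun n : ℕ =>
              (if n ∈ (Finset.Ico 1 ⌈Skeleton.P1 D⌉₊).filter
                    (fun n : ℕ => ¬ (n : ℝ) < bigP D ^ (1 / 2 : ℝ))
                then χ (n : ZMod D) * vk1 D n else 0) -
              (if n ∈ (Finset.Ico 1 ⌈Skeleton.P1 D * etaPM D 1⌉₊).filter
                    (fun n : ℕ => bigP D ^ (0.5 : ℝ) * etaPM D (-1) < n ∧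
                      (n : ℝ) < Skeleton.P1 D * etaPM D 1)
                then χ (n : ZMod D) * vk12 D n else 0))
            (fun n : ℕ => conj (
              (if n ∈ (Finset.Ico 1 ⌈Skeleton.P1 D⌉₊).filter
                    (fun n : ℕ => ¬ (n : ℝ) < bigP D ^ (1 / 2 : ℝ))
                then χ (n : ZMod D) * vk1 D n else 0) -
              (if n ∈ (Finset.Ico 1 ⌈Skeleton.P1 D * etaPM D 1⌉₊).filter
                    (fun n : ℕ => bigP D ^ (0.5 : ℝ) * etaPM D (-1) < n ∧
                      (n : ℝ) < Skeleton.P1 D * etaPM D 1)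
                then χ (n : ZMod D) * vk12 D n else 0)))‖ ≤
          ε * alpha D * frakA χ := by
  intro ε hε
  obtain ⟨a₀, ha₀, hA⟩ := frakALowerBound_holds
  obtain ⟨K, hK, hgen⟩ := norm_Sj_conj_sub_inner_le
  obtain ⟨DK, hDK⟩ := hgen c'
  have hε2 : 0 < ε / 2 := by positivity
  obtain ⟨D₁, h₁⟩ := (hIn (ε / 2) hε2).and hA
  -- the budget threshold: `K·5·10¹²·𝓛⁻¹³ ≤ (ε/2)·(π𝓛⁻⁹)·a₀` once `𝓛 ≥ L`
  set L : ℝ := 2 * (K * 5000000000000) / (ε * π * a₀) + 3 with hL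
  have hL3 : 3 ≤ L := by
    have : 0 ≤ 2 * (K * 5000000000000) / (ε * π * a₀) := by positivity
    linarith
  refine ⟨max (max D₁ DK) ⌈Real.exp L⌉₊, fun D _ χ hD hq hp hAss j hj => ?_⟩
  have hD₁ : D₁ ≤ D := le_trans (le_trans (le_max_left _ _) (le_max_left _ _)) hD
  have hDK' : DK ≤ D := le_trans (le_trans (le_max_right _ _) (le_max_left _ _)) hD
  have hDL : ⌈Real.exp L⌉₊ ≤ D := le_trans (le_max_right _ _) hD
  have hℓL : L ≤ ell D := le_ell_of_ceil_exp_le_pieces hDL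
  have hℓ3 : 3 ≤ ell D := le_trans hL3 hℓL
  have hℓ1 : 1 ≤ ell D := by linarith
  have hℓ2 : 2 ≤ ell D := by linarith
  have hℓ0 : 0 < ell D := by linarith
  have hD2 : 2 ≤ D := two_le_of_ceil_exp_le (by linarith) hDL
  obtain ⟨hcore, hA'⟩ := h₁ D χ hD₁ hq hp
  have ha : a₀ ≤ frakA χ := hA' hAss
  have hα : alpha D = π / ell D ^ 9 := by rw [alpha, bigP, Real.log_exp]
  have hα0 : 0 < alpha D := by rw [hα]; positivity
  -- the core
  have hc : ‖Sj c' D j (b126In D χ) (fun n : ℕ => conj (b126In D χ n))‖ ≤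
      ε / 2 * alpha D * frakA χ := hcore hAss j hj
  -- the eight non-core pairs
  have hx₁ : 0 < Real.exp (ell D ^ 9 / 2) := Real.exp_pos _
  have hx₂ : 0 < Real.exp (0.504 * ell D ^ 9) := Real.exp_pos _
  have h9 : 0 ≤ ell D ^ 9 := by positivity
  have hx₁P : Real.exp (ell D ^ 9 / 2) ≤ bigP D := by
    rw [bigP]; exact Real.exp_le_exp.mpr (by linarith)
  have hx₂P : Real.exp (0.504 * ell D ^ 9) ≤ bigP D := by
    rw [bigP]; exact Real.exp_le_exp.mpr (by linarith)
  have hrest := hDK D hDK' j (Real.exp (ell D ^ 9 / 2)) (Real.exp (0.504 * ell D ^ 9))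
    hx₁ hx₁P hx₂ hx₂P 0.005 (2000000 * (ell D ^ 24)⁻¹) (0.192 * (ell D ^ 40)⁻¹)
    (b126 D χ) (b126In D χ) (b126Near D χ) (b126Far D χ) (b126_decomp D χ)
    (norm_b126In_le χ hD2 hℓ2) (norm_b126Near_le χ hD2 hℓ1) (norm_b126Far_le χ hD2 hℓ1)
    (fun n hn => Or.inl (window_of_b126In_ne_zero χ hD2 hℓ1 hn))
    (fun n hn => window_of_b126Near_ne_zero χ hD2 hn)
  have hineq : K * 5000000000000 ≤ ε * π * a₀ / 2 * ell D ^ 4 := by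
    have hM : 2 * (K * 5000000000000) / (ε * π * a₀) ≤ ell D := by linarith
    have hM' := (div_le_iff₀ (by positivity : (0 : ℝ) < ε * π * a₀)).mp hM
    have h4 : ell D ≤ ell D ^ 4 := le_self_pow₀ hℓ1 (by norm_num)
    have hpos : 0 ≤ ε * π * a₀ := by positivity
    nlinarith [mul_le_mul_of_nonneg_left h4 hpos]
  have hbudget : K * (0.005 * (2000000 * (ell D ^ 24)⁻¹) * ell D ^ 8 +
      0.005 * (0.192 * (ell D ^ 40)⁻¹) * ell D ^ 27 +
      (2000000 * (ell D ^ 24)⁻¹ + 0.192 * (ell D ^ 40)⁻¹) ^ 2 * ell D ^ 27) ≤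
      ε / 2 * alpha D * a₀ := by
    have h13 : ell D ^ 13 = ell D ^ 4 * ell D ^ 9 := by rw [← pow_add]
    calc _ ≤ K * (5000000000000 * (ell D ^ 13)⁻¹) :=
          mul_le_mul_of_nonneg_left (pieces_budget hℓ1) hK
      _ = (K * 5000000000000) * (ell D ^ 4)⁻¹ * (ell D ^ 9)⁻¹ := by
          rw [h13, mul_inv]; ring
      _ ≤ (ε * π * a₀ / 2 * ell D ^ 4) * (ell D ^ 4)⁻¹ * (ell D ^ 9)⁻¹ := by
          gcongr
      _ = ε / 2 * alpha D * a₀ := by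
          rw [mul_inv_cancel_right₀ (pow_ne_zero 4 hℓ0.ne'), hα]; ring
  have hrest' : ‖Sj c' D j (b126 D χ) (fun n : ℕ => conj (b126 D χ n)) -
      Sj c' D j (b126In D χ) (fun n : ℕ => conj (b126In D χ n))‖ ≤ ε / 2 * alpha D * frakA χ := by
    refine le_trans (le_trans hrest hbudget) ?_
    have : 0 ≤ ε / 2 * alpha D := by positivity
    exact mul_le_mul_of_nonneg_left ha this
  -- conclude
  change ‖Sj c' D j (b126 D χ) (fun n : ℕ => conj (b126 D χ n))‖ ≤ ε * alpha D * frakA χ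
  calc ‖Sj c' D j (b126 D χ) (fun n : ℕ => conj (b126 D χ n))‖
      ≤ ‖Sj c' D j (b126In D χ) (fun n : ℕ => conj (b126In D χ n))‖ +
          ‖Sj c' D j (b126 D χ) (fun n : ℕ => conj (b126 D χ n)) -
            Sj c' D j (b126In D χ) (fun n : ℕ => conj (b126In D χ n))‖ := norm_le_insert' _ _
    _ ≤ ε / 2 * alpha D * frakA χ + ε / 2 * alpha D * frakA χ := add_le_add hc hrest'
    _ = ε * alpha D * frakA χ := by ring

end Literature.NumberTheory.LFunctions.Zhang2022.Typed.Sec12A
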